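import Summits.QuantumFields.BalabanUV.T4Continuum.Spine.NE1p.DressedSmallFieldPencil

/-!
# T⁴ programme, spine estimate NE1′ (node O3b/H2) — WITNESS W23: the source pencil `DressedSmallFieldPencil` (owner node N0j, p220020) FIRES on
# DECIDED polymer catalogues — its whole socket list jointly inhabited AT `Finset.univ`, all six N0j ENDs reached BY NAME; §B on a NON-DEGENERATE
# two-cube catalogue with (2.41)'s decay LIVE in the closed numerals

Cell `pub-balaban`, sub-cell `t4`, row NE1′ formalisation crew (`t4/formal/NE1p/LEAVES.md` row W23 ∕ DAG N29y; typer R-T89 (i), R-T90 (ii)), unit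
`b2b-balaban-t4-ne1p-formalise-leaf-08` (gen 6); row suggested by the owner lineage t4-ne1p-p1 (gen 26, memo `OWNER-ANSWERS-g26.md` §4, §6 (d)).
ADDITIVE — imports `Spine/NE1p/DressedSmallFieldPencil` ONLY; toy DATA `def`s + theorems; 0 `def … : Prop` (the incompatibility relations are `(@Eq Unit)`
and the tree's `polyInc on cubes₂`, inline), 0 cite, 0 sorry.

WHAT THIS FILE DOES.  N0j composes the tree's Kotecký–Preiss kernels BY NAME under DISPLAYED sockets: footprint-local incompatibility `hloc`∕`hreach`, the
geometry shapes `h126 : Ineq126`, `hvol : VolBound`, `h227 : Ineq227` (`B13FamilySum`), the one-run clauses `hrate`∕`hsmall`∕`hb`, the per-polymer source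
data (E1) `hhol` ∕ (E2) `hm`, and the (2.38)-SHAPE `hL3`.  Two DECIDED finite catalogues discharge EVERY socket at once, so N0j's conclusions become closed
numerals; each socket is a named lemma below (several TIGHT), each N0j END is applied ONCE by name, and GENUINENESS (the μ-part is NOT zero) is proved
through B13's (2.11)–(2.12) identity `B13Resummation.exp_sum_locE_eq_Z` BY NAME and the catalogues' explicit partition functions:
* §A THE OWNER'S ONE-CUBE DATUM (memo §4 verbatim): `Dom = Cube = Unit`, `ι = Eq`, `cubes () = reach () = {()}`, `d ≡ 0`, `κ₀ = r₁ = b = c = dX = 0`,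
  `K₀ = c₁ = ν = 1`, `R = 2`, `A = 1∕3`, `act s () = s∕(3μ₁)`, `m () = 1∕3`: N0j §1 `muPart_locE_le` fires (`muPart_fires₁`, closed form
  `‖E_μ − E_0‖ ≤ (e∕3)·μ₀∕(μ₁ − μ₀)`), live by `locE₁_live` (`Z = 1 + act μ ()`).
* §B A NON-DEGENERATE TWO-CUBE CATALOGUE: cubes `Fin 2`; polymers `p0 = {0}`, `p1 = {1}`, `p01 = {0,1}`; incompatibility = FOOTPRINT OVERLAP `polyInc on cubes₂` (NOT equality:
  `p0 ∼ p01`, `p1 ∼ p01`, `p0 ≁ p1`); `reach = cubes`, `ν = 1`; `d p0 = d p1 = 0`, `d p01 = 1`; `X = {0,1}`, `dX = 1`; `Ineq126` at `κ₀ = 1`, `K₀ = 3∕2`;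
  `VolBound` at `c₁ = 1`; `Ineq227` at `c = 1`; `r₁ = b = 1`, `R = 5`, `A = 1∕12` (`hsmall ⇔ e² ≤ 8`); `m Z := (1∕12)·e^{−5·d Z}`, `act ρ s Z := (s∕ρ)·m Z`.
  ALL SIX N0j theorems fire (`muPart_fires₂`, `norm_fires₂`, `regen_fires₂`, `differentiableOn_fires₂`, `muDeriv_fires₂`, `schwarz_fires₂`) with the
  decay `e^{−r₁·dX} = e⁻¹` live: envelope `e·(3∕2)²·(1∕12)·e⁻¹ = 3∕16` (`envelope₂_eq`); live by `sum_locE₂_live` (`Z₂_eq`).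
* §0 numeric certificates `e⁻¹ ≤ 1∕2`, `e² ≤ 8` (and `e∕3 ≤ 1` inline) (Mathlib `Real.add_one_le_exp` ∕ `Real.exp_one_lt_d9`; second engine: exact rationals + an interval for
  `e`, `HOME/b2b-balaban-t4-ne1p-formalise-leaf-08/g6/engine2_w23.py`).  Planted mutants (NOT filed, `…/leaf-08/g6/Mutants_W23.NOT-TO-FILE.lean`, rc 1):
  `A := 1∕8` in §B (`hsmall` would need `e² ≤ 16∕3`), `c := 0` in `Ineq227` (fails on `D = {p0, p1}`), `K₀ := 1` in `Ineq126` (fails at cube `0`).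

WHAT IS AND IS NOT NEW (typer R-T89 (i)(f) ∕ R-T90 (ii)(g)).  The shapes `Ineq126`∕`VolBound`∕`Ineq227` are ALREADY inhabited in the tree: on a decided
one-cube tower in `Support/ClusterRepOfDomainsWitness.lean` (`toy_ineq126`, `toy_volBound`, `toy_ineq227`), on the torus tree-length geometry in
`Support/B13DomainGeometry.lean` (`ineq126_domAt`, `volBound_domAt`, `ineq227_dom`) and `Support/B13DomainGeometryTR.lean` (`ineq126_level`,
`volBound_level`, `ineq227_level`), and (owner N0l, same day) in `Spine/NE1p/DressedTableOfBirths.lean` §3 (its own `toy_ineq126`, `toy_volBound`,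
`toy_ineq227`) — all cited BY NAME as context, not imported.  What this file is first at: (1) the JOINT inhabitation of N0j's whole socket list AT
`Finset.univ` (geometry + clauses + (E1)∕(E2) + `hL3`) reaching all six N0j ENDs BY NAME; (2) §B's NON-DEGENERATE catalogue — two cubes, an
incompatibility that is not equality with a non-trivial `hloc`, live tree length, `Ineq227` TIGHT at `c = 1`, (2.41)'s decay live in closed numerals.  It
answers the owner's §6 (d) as a kernel fact about the SHAPE only: `Ineq227` CAN be inhabited as typed (`c = 1` on two cubes) — nothing about Bałaban's `d_k`.

HONEST FRAMING.  A DECIDED TOY inhabits N0j's sockets jointly; 0 binders instantiated on Bałaban's densities, localization domains `d_k`, minimisers,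
backgrounds or value maps; `hL3` is this programme's UNPRINTED binder (the dressed (2.38)-SHAPE = node U3∕NE9's potential-KP uniformity, GAPS G-ne9p2-5),
toy-true here BY CHOICE of `m`; (w1)∕(w5)∕(w6)∕PAY untouched as estimates; NE1′ ⇐ the named binders — NOT proved, NOT printed; spine PROVED 0∕9; count 9
unchanged.  Rung (B)+1 on ONE finite four-torus — NOT infinite volume, NOT a mass gap, NOT OS on ℝ⁴, NOT Clay.  HONEST DEPENDENCY: continuum YM on T⁴ ⇐
BetaPertH ∧ nine spine estimates (0/9 proved); BetaPertH ⇐ (D1) ∧ (D4) ∧ CAP+tail; G-an2-4 gates asym, D1 and NE2/3/4.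
-/

noncomputable section

namespace Summit.QuantumFields.BalabanUV.T4Continuum.NE1p.DressedSmallFieldPencilWitness

open Finset Metric Complex
open scoped Function
open Literature.MathematicalPhysics.QuantumFieldTheory.Balaban1983to89.B13FamilySum (Ineq126 VolBound Ineq227 mem_coveringFamilies)
open Literature.MathematicalPhysics.QuantumFieldTheory.Balaban1983to89.B13Resummation (locE locE_congr exp_sum_locE_eq_Z)
open Literature.Probability.LatticeModels (polyInc polymerPartitionFunction polymerPartitionFunction_insert polymerPartitionFunction_empty)
open Summit.QuantumFields.BalabanUV.T4Continuum.NE1p.DressedSmallFieldPencil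

/-! ## §0 Numeric certificates for the clauses -/

/-- `e² ≤ 8` (Mathlib `Real.exp_one_lt_d9`: `e² < 2.7182818286² < 8`). -/
theorem exp_two_le_eight : Real.exp (1 + 1) ≤ 8 := by
  rw [Real.exp_add]; have h := Real.exp_one_lt_d9; have h0 := Real.exp_pos (1 : ℝ); nlinarith

/-! ## §A THE OWNER'S ONE-CUBE DATUM (memo g26 §4 verbatim): one cube, one polymer, `ι = Eq` -/

section OneCube
/-- One cube: the footprint (and the reach) of the one polymer is the one cube.  The incompatibility relation of §A is equality on `Unit`,
written `(@Eq Unit)` inline (no `def … : Prop`). -/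
def cubes₁ : Unit → Finset Unit := fun _ => {()}

/-- Tree length `d ≡ 0`. -/
def d₁ : Unit → ℝ := fun _ => 0

/-- The source-free majorant `m () = 1∕3`. -/
def m₁ : Unit → ℝ := fun _ => 1 / 3

/-- The dressed activity of the owner's datum: `act s () = s∕(3μ₁)` (entire in the source `s`). -/
def act₁ (μ₁ : ℝ) : ℂ → Unit → ℂ := fun s _ => s / (3 * (μ₁ : ℂ))

/-- Socket `hloc` on the one-cube datum (reach = the cube); `hreach` (`ν = 1`), `hd`, `hrate` (`0 + 2·0 + 2 ≤ 2`, TIGHT) and `hb` are the inline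
`norm_num`∕`le_rfl` terms at the call sites below. -/
theorem hloc₁ : ∀ Z Z' : Unit, (@Eq Unit) Z' Z → ∃ q ∈ cubes₁ Z, q ∈ cubes₁ Z' := by decide

/-- Socket (1.26) `Ineq126` on the one-cube datum at `κ₀ = 0`, `K₀ = 1`: the one polymer containing the cube weighs `e⁰ = 1` — TIGHT. -/
theorem h126₁ : Ineq126 (univ : Finset Unit) cubes₁ d₁ 0 1 := by
  intro c
  have hf : (univ : Finset Unit).filter (fun Y => c ∈ cubes₁ Y) = {()} := by obtain ⟨⟩ := c; decide
  rw [hf, sum_singleton]; simp [d₁]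

/-- Socket (2.30) `VolBound` on the one-cube datum at `c₁ = 1`: `1 ≤ 1·(1 + 0)` — TIGHT. -/
theorem hvol₁ : VolBound (univ : Finset Unit) cubes₁ d₁ 1 := by intro Y _; simp [cubes₁, d₁]

/-- Socket (2.27) `Ineq227` on the one-cube datum at `dX = c = 0`: `0 ≤ Σ 0` over every covering family. -/
theorem h227₁ : Ineq227 (univ : Finset Unit) cubes₁ d₁ {()} 0 0 := by intro D _; simp [d₁]

/-- Socket `hsmall` : `A·e^{b+1}·K₀·ν·c₁ ≤ 1` at `A = 1∕3`, `b = 0`, i.e. `e∕3 ≤ 1`. -/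
theorem hsmall₁ : (1 / 3 : ℝ) * Real.exp (0 + 1) * 1 * 1 * 1 ≤ 1 := by
  rw [zero_add]; have h := Real.exp_one_lt_d9; norm_num at h ⊢; linarith

/-- The size of the owner's activity: `‖act s ()‖ = ‖s‖∕(3μ₁) ≤ 1∕3` for `‖s‖ ≤ μ₁`, `0 < μ₁`. -/
theorem norm_act₁_le {μ₁ : ℝ} (hμ₁ : 0 < μ₁) {s : ℂ} (hs : ‖s‖ ≤ μ₁) (Z : Unit) : ‖act₁ μ₁ s Z‖ ≤ 1 / 3 := by
  have h3 : ‖(3 : ℂ) * (μ₁ : ℂ)‖ = 3 * μ₁ := by rw [norm_mul, Complex.norm_real, Real.norm_of_nonneg hμ₁.le]; simp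
  show ‖s / (3 * (μ₁ : ℂ))‖ ≤ 1 / 3
  rw [norm_div, h3, div_le_div_iff₀ (by positivity) (by norm_num)]; linarith

/-- Socket (E1) `hhol` on the one-cube datum: the activity is complex differentiable in the source on the disc. -/
theorem hhol₁ (μ₁ : ℝ) : ∀ Z : Unit, cubes₁ Z ⊆ {()} → DifferentiableOn ℂ (fun s => act₁ μ₁ s Z) (ball (0 : ℂ) μ₁) :=
  fun _ _ => (differentiable_id.div_const _).differentiableOn

/-- Socket (E2) `hm` on the one-cube datum: `‖act s ()‖ ≤ m () = 1∕3` on the source disc. -/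
theorem hm₁ {μ₁ : ℝ} : ∀ s ∈ ball (0 : ℂ) μ₁, ∀ Z : Unit, cubes₁ Z ⊆ {()} → ‖act₁ μ₁ s Z‖ ≤ m₁ Z := fun s hs Z _ => by
  rw [mem_ball_zero_iff] at hs; exact norm_act₁_le ((norm_nonneg s).trans_lt hs) hs.le Z

/-- Socket `hL3` — the (2.38)-SHAPE at `A = 1∕3`, `R = 2`: `1∕3 ≤ (1∕3)·e⁰` — TIGHT; toy-true BECAUSE `m` is chosen so, NOT (2.38) for any dressed
activity. -/
theorem hL3₁ : ∀ Z : Unit, cubes₁ Z ⊆ {()} → m₁ Z ≤ 1 / 3 * Real.exp (-(2 * d₁ Z)) := by intro Z _; simp [m₁, d₁]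

/-- **N0j §1 `muPart_locE_le` FIRES ON THE OWNER'S ONE-CUBE DATUM** (applied ONCE, by name; every socket discharged; the face's conclusion LITERALLY
at the datum's letters): `‖E_μ({()}) − E_0({()})‖ ≤ e·1·1·1²·(1∕3)·e^{−0·0} · μ₀∕(μ₁ − μ₀)` on `‖μ‖ ≤ μ₀ < μ₁`. -/
theorem muPart_fires₁ {μ₁ μ₀ : ℝ} {μ : ℂ} (h0 : 0 < μ₀) (h01 : μ₀ < μ₁) (hμ : ‖μ‖ ≤ μ₀) :
    ‖locE (@Eq Unit) cubes₁ (act₁ μ₁ μ) {()} - locE (@Eq Unit) cubes₁ (act₁ μ₁ 0) {()}‖ ≤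
      Real.exp 1 * 1 * 1 * 1 ^ 2 * (1 / 3) * Real.exp (-(0 * 0)) * (μ₀ / (μ₁ - μ₀)) :=
  muPart_locE_le (@Eq Unit) (reach := cubes₁) (d := d₁) (m := m₁) (A := 1 / 3) (R := 2) (r₁ := 0) (κ₀ := 0) (K₀ := 1) (c₁ := 1) (c := 0) (b := 0) (ν := 1)
    (dX := 0) hloc₁ (fun Z => by rw [one_mul]) (fun _ => le_rfl) (by norm_num) (by norm_num) (by norm_num) (by norm_num) le_rfl le_rfl le_rfl (by norm_num)
    h126₁ hvol₁ h227₁ (by norm_num) hsmall₁ (singleton_nonempty ()) (hhol₁ μ₁) hm₁ hL3₁ h0 h01 hμ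

/-- The same in closed form: `‖E_μ({()}) − E_0({()})‖ ≤ (e∕3)·μ₀∕(μ₁ − μ₀)` — the pencil factor `μ₀∕(μ₁ − μ₀)` visible. -/
theorem muPart_fires₁' {μ₁ μ₀ : ℝ} {μ : ℂ} (h0 : 0 < μ₀) (h01 : μ₀ < μ₁) (hμ : ‖μ‖ ≤ μ₀) :
    ‖locE (@Eq Unit) cubes₁ (act₁ μ₁ μ) {()} - locE (@Eq Unit) cubes₁ (act₁ μ₁ 0) {()}‖ ≤ Real.exp 1 / 3 * (μ₀ / (μ₁ - μ₀)) := by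
  have h := muPart_fires₁ h0 h01 hμ
  simp only [mul_one, one_pow, mul_zero, neg_zero, Real.exp_zero] at h
  simpa [div_eq_mul_inv] using h

/-- The one-polymer partition function: `Z({()}; w) = 1 + w ()`. -/
theorem Z₁_eq (w : Unit → ℂ) : polymerPartitionFunction (@Eq Unit) w univ = 1 + w () := by
  have hu : (univ : Finset Unit) = insert () ∅ := by decide
  rw [hu, polymerPartitionFunction_insert (fun _ _ h => h.symm) w (Finset.notMem_empty _)]; simp

/-- B13's (2.11)–(2.12) identity `B13Resummation.exp_sum_locE_eq_Z` FIRES on the one-cube datum (by name; its own sockets at `τ = 1`, `s = b = 0`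
discharged): `exp(Σ_X E_μ(X)) = 1 + μ∕(3μ₁)` for `‖μ‖ ≤ μ₁`. -/
theorem exp_sum_locE₁ {μ₁ : ℝ} {μ : ℂ} (hμ₁ : 0 < μ₁) (hμ : ‖μ‖ ≤ μ₁) :
    Complex.exp (∑ X ∈ (univ : Finset Unit).powerset.image (fun C => C.biUnion cubes₁), locE (@Eq Unit) cubes₁ (act₁ μ₁ μ) X) = 1 + μ / (3 * (μ₁ : ℂ)) := by
  have hw : ∀ Z : Unit, ‖act₁ μ₁ μ Z‖ ≤ 1 / 3 * Real.exp (-(2 * d₁ Z)) := fun Z => by simpa [d₁] using norm_act₁_le hμ₁ hμ Z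
  have h := exp_sum_locE_eq_Z (@Eq Unit) (w := act₁ μ₁ μ) (reach := cubes₁) (d := d₁) (A := 1 / 3) (R := 2) (κ₀ := 0) (K₀ := 1) (c₁ := 1) (τ := 1) (s := 0)
    (b := 0) (ν := 1) hloc₁ (fun Z => by rw [one_mul]) (fun _ => le_rfl) (by norm_num) (by norm_num) (by norm_num) le_rfl le_rfl hw h126₁ hvol₁
    (by norm_num) (by simpa only [one_mul, mul_one] using hsmall₁)
  rw [h, Z₁_eq]; rfl

/-- **GENUINE — THE μ-PART IS NOT ZERO ON THE ONE-CUBE DATUM**: `E_μ({()}) ≠ E_0({()})` for every `μ ≠ 0` with `‖μ‖ ≤ μ₁` (e.g. `μ = μ₀`), so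
`muPart_fires₁` bounds a NON-ZERO quantity (`E(∅)` does not see the activity, by `locE_congr`; the total moves with `Z = 1 + μ∕(3μ₁)`). -/
theorem locE₁_live {μ₁ : ℝ} {μ : ℂ} (hμ₁ : 0 < μ₁) (hμ : ‖μ‖ ≤ μ₁) (hne : μ ≠ 0) :
    locE (@Eq Unit) cubes₁ (act₁ μ₁ μ) {()} ≠ locE (@Eq Unit) cubes₁ (act₁ μ₁ 0) {()} := by
  intro heq
  have hall : ∀ X : Finset Unit, locE (@Eq Unit) cubes₁ (act₁ μ₁ μ) X = locE (@Eq Unit) cubes₁ (act₁ μ₁ 0) X := by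
    intro X
    by_cases hX : () ∈ X
    · have hXu : X = {()} := by ext u; obtain ⟨⟩ := u; simpa using hX
      rw [hXu]; exact heq
    · have hXe : X = ∅ := by ext u; obtain ⟨⟩ := u; simpa using hX
      rw [hXe]; exact locE_congr (@Eq Unit) fun Z hZ => absurd (hZ (by simp [cubes₁])) (Finset.notMem_empty ())
  have h1 := exp_sum_locE₁ hμ₁ hμ
  have h0 := exp_sum_locE₁ (μ := 0) hμ₁ (by rw [norm_zero]; exact hμ₁.le)
  rw [Finset.sum_congr rfl fun X _ => hall X, h0, zero_div, add_zero] at h1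
  have hz : μ / (3 * (μ₁ : ℂ)) = 0 := by have := h1.symm; rwa [add_eq_left] at this
  exact hne ((div_eq_zero_iff.1 hz).resolve_right (mul_ne_zero three_ne_zero (by exact_mod_cast hμ₁.ne')))

end OneCube

/-! ## §B A NON-DEGENERATE TWO-CUBE CATALOGUE: three polymers, footprint overlap, every shape with live letters -/

section TwoCubes
/-- The three polymers of the two-cube catalogue: `p0 = {0}`, `p1 = {1}`, `p01 = {0, 1}`. -/
inductive Pol
  | p0
  | p1
  | p01
  deriving DecidableEq, Fintype
open Pol

/-- Footprints: `p0 ↦ {0}`, `p1 ↦ {1}`, `p01 ↦ {0, 1}` (cubes of `Fin 2`); the reach of a polymer is its footprint. -/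
def cubes₂ : Pol → Finset (Fin 2)
  | p0 => {0}
  | p1 => {1}
  | p01 => {0, 1}

/-- Incompatibility = FOOTPRINT OVERLAP, written inline as the tree's subset incompatibility `polyInc` (equal or intersecting finsets,
`Literature/Probability/LatticeModels/PolymerPressure`) pulled back along the footprint map: `(polyInc on cubes₂) Z Z' ↔ cubes Z ∩ cubes Z' ≠ ∅`
here (footprints are nonempty and `cubes₂` is injective); no `def … : Prop`.  Decidability of the pulled-back relation. -/
instance instDecidableRelOverlap : DecidableRel (polyInc on cubes₂) := fun Z Z' => inferInstanceAs (Decidable (polyInc (cubes₂ Z) (cubes₂ Z')))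

/-- Overlap is reflexive (footprints are nonempty). -/
instance instReflOverlap : Std.Refl (polyInc on cubes₂) := ⟨by decide⟩

/-- Overlap is symmetric. -/
instance instSymmOverlap : Std.Symm (polyInc on cubes₂) := ⟨by decide⟩

/-- The relation table: the singletons overlap the pair, not each other — the overlap relation is NOT equality. -/
theorem overlap_table : (polyInc on cubes₂) p0 p01 ∧ (polyInc on cubes₂) p1 p01 ∧ ¬ (polyInc on cubes₂) p0 p1 ∧ (polyInc on cubes₂) ≠ Eq :=
  ⟨by decide, by decide, by decide, fun h => absurd (Eq.mp (congrFun (congrFun h p0) p01) (by decide)) (by decide)⟩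

/-- Tree lengths: `d p0 = d p1 = 0`, `d p01 = 1`. -/
def d₂ : Pol → ℝ
  | p0 => 0
  | p1 => 0
  | p01 => 1

/-- The source-free majorant in the (2.38)-shape at `A = 1∕12`, `R = 5`: `m Z = (1∕12)·e^{−5·d Z}`. -/
def m₂ (Z : Pol) : ℝ := 1 / 12 * Real.exp (-(5 * d₂ Z))

/-- The dressed activities of the two-cube catalogue with source radius `ρ`: `act ρ s Z = (s∕ρ)·m Z`. -/
def act₂ (ρ : ℝ) (s : ℂ) (Z : Pol) : ℂ := s / (ρ : ℂ) * (m₂ Z : ℂ)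

/-- Socket `hd` : `0 ≤ d`. -/
theorem hd₂ : ∀ Z, 0 ≤ d₂ Z := fun Z => by cases Z <;> norm_num [d₂]

/-- `0 ≤ m`. -/
theorem m₂_nonneg (Z : Pol) : 0 ≤ m₂ Z := by unfold m₂; positivity

/-- Socket `hloc` on the two-cube catalogue — NON-TRIVIAL: overlapping polymers share a cube of the reach (= footprint); `hreach` (`ν = 1`), `hrate`
(`1 + 2·1 + 2 ≤ 5`, TIGHT) and `hb` (`1·1 ≤ 1`, TIGHT) are the inline `one_mul`∕`norm_num` terms at the call sites below. -/
theorem hloc₂ : ∀ Z Z' : Pol, (polyInc on cubes₂) Z' Z → ∃ q ∈ cubes₂ Z, q ∈ cubes₂ Z' := by decide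

/-- **Socket (1.26) `Ineq126` at `κ₀ = 1`, `K₀ = 3∕2`**: each cube lies in its singleton (weight `e⁰`) and in the pair (weight `e⁻¹`); `1 + e⁻¹ ≤ 3∕2`. -/
theorem h126₂ : Ineq126 (univ : Finset Pol) cubes₂ d₂ 1 (3 / 2) := by
  intro c
  have he : Real.exp (-1) ≤ 1 / 2 := by  -- `e⁻¹ ≤ 1∕2` from Mathlib's `Real.add_one_le_exp` (`2 ≤ e`)
    have h := Real.add_one_le_exp (1 : ℝ); norm_num at h; rw [Real.exp_neg]; exact (inv_anti₀ (by norm_num) h).trans_eq (by norm_num)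
  have key : ∀ c : Fin 2, (univ : Finset Pol).filter (fun Y => c ∈ cubes₂ Y) = if c = 0 then {p0, p01} else {p1, p01} := by decide
  rw [key]
  split_ifs
  · rw [sum_pair (by decide)]; norm_num [d₂]; linarith
  · rw [sum_pair (by decide)]; norm_num [d₂]; linarith

/-- **Socket (2.30) `VolBound` at `c₁ = 1`** — TIGHT on every polymer: `1 ≤ 1·(1+0)`, `2 ≤ 1·(1+1)`. -/
theorem hvol₂ : VolBound (univ : Finset Pol) cubes₂ d₂ 1 := by intro Y _; cases Y <;> norm_num [cubes₂, d₂]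

/-- **Socket (2.27) `Ineq227` for the union `X = {0,1}` (`dX = 1`) at `c = 1`**: a covering family of `{0,1}` by pairwise different polymers either
contains `p01` (one summand `1 + 1`) or contains both singletons (`(0+1) + (0+1)`) — TIGHT in both cases; so the shape IS inhabitable as typed with
`c > 0` (owner memo §6 (d)). -/
theorem h227₂ : Ineq227 (univ : Finset Pol) cubes₂ d₂ univ 1 1 := by
  intro D hD
  obtain ⟨-, hU⟩ := mem_coveringFamilies.1 hD
  have hnn : ∀ Y ∈ D, 0 ≤ d₂ Y + 1 := fun Y _ => by cases Y <;> norm_num [d₂]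
  by_cases h01 : p01 ∈ D
  · calc (1 : ℝ) + 1 = d₂ p01 + 1 := by norm_num [d₂]
      _ ≤ ∑ Y ∈ D, (d₂ Y + 1) := single_le_sum hnn h01
  · have hmem : ∀ q : Fin 2, ∃ Y ∈ D, q ∈ cubes₂ Y := fun q => by
      have hq : q ∈ D.biUnion cubes₂ := by rw [hU]; exact mem_univ q
      simpa only [mem_biUnion] using hq
    have h0 : p0 ∈ D := by obtain ⟨Y, hY, hq⟩ := hmem 0; cases Y; exacts [hY, absurd hq (by decide), absurd hY h01]
    have h1 : p1 ∈ D := by obtain ⟨Y, hY, hq⟩ := hmem 1; cases Y; exacts [absurd hq (by decide), hY, absurd hY h01]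
    have hsub : ({p0, p1} : Finset Pol) ⊆ D := by
      intro Y hY
      simp only [mem_insert, mem_singleton] at hY
      rcases hY with rfl | rfl
      exacts [h0, h1]
    calc (1 : ℝ) + 1 = (d₂ p0 + 1) + (d₂ p1 + 1) := by norm_num [d₂]
      _ = ∑ Y ∈ ({p0, p1} : Finset Pol), (d₂ Y + 1) := by rw [sum_pair (by decide)]
      _ ≤ ∑ Y ∈ D, (d₂ Y + 1) := sum_le_sum_of_subset_of_nonneg hsub fun Y hY _ => hnn Y hY

/-- Socket `hsmall` : `A·e^{b+1}·K₀·ν·c₁ ≤ 1` at `A = 1∕12`, `b = 1`, `K₀ = 3∕2`, i.e. `e²∕8 ≤ 1`. -/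
theorem hsmall₂ : (1 / 12 : ℝ) * Real.exp (1 + 1) * (3 / 2) * 1 * 1 ≤ 1 := by
  have e : (1 / 12 : ℝ) * Real.exp (1 + 1) * (3 / 2) * 1 * 1 = Real.exp (1 + 1) / 8 := by ring
  rw [e, div_le_one (by norm_num)]; exact exp_two_le_eight

/-- The size of the activities: `‖act ρ s Z‖ ≤ m Z` for `‖s‖ ≤ ρ`, `0 < ρ`. -/
theorem norm_act₂_le {ρ : ℝ} (hρ : 0 < ρ) {s : ℂ} (hs : ‖s‖ ≤ ρ) (Z : Pol) : ‖act₂ ρ s Z‖ ≤ m₂ Z := by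
  unfold act₂
  rw [norm_mul, norm_div, Complex.norm_real, Complex.norm_real, Real.norm_of_nonneg hρ.le, Real.norm_of_nonneg (m₂_nonneg Z)]
  calc ‖s‖ / ρ * m₂ Z ≤ 1 * m₂ Z := by gcongr; exacts [m₂_nonneg Z, (div_le_one hρ).2 hs]
    _ = m₂ Z := one_mul _

/-- Socket (E1) `hhol` on the two-cube catalogue: the activities are complex differentiable in the source on the disc `‖s‖ < ρ`. -/
theorem hhol₂ (ρ : ℝ) : ∀ Z : Pol, cubes₂ Z ⊆ univ → DifferentiableOn ℂ (fun s => act₂ ρ s Z) (ball (0 : ℂ) ρ) :=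
  fun _ _ => ((differentiable_id.div_const _).mul_const _).differentiableOn

/-- Socket (E2) `hm` on the two-cube catalogue: `‖act ρ s Z‖ ≤ m Z` on the disc `‖s‖ < ρ`. -/
theorem hm₂ {ρ : ℝ} : ∀ s ∈ ball (0 : ℂ) ρ, ∀ Z : Pol, cubes₂ Z ⊆ univ → ‖act₂ ρ s Z‖ ≤ m₂ Z := fun s hs Z _ => by
  rw [mem_ball_zero_iff] at hs; exact norm_act₂_le ((norm_nonneg s).trans_lt hs) hs.le Z

/-- Socket `hL3` — the (2.38)-SHAPE at `A = 1∕12`, `R = 5`, with equality; toy-true BY CHOICE of `m`, NOT (2.38) for any dressed activity. -/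
theorem hL3₂ : ∀ Z : Pol, cubes₂ Z ⊆ univ → m₂ Z ≤ 1 / 12 * Real.exp (-(5 * d₂ Z)) := fun _ _ => le_rfl

/-- **N0j §1 `muPart_locE_le` FIRES ON THE TWO-CUBE CATALOGUE** (ONE application by name, every socket discharged; the conclusion LITERALLY at the
catalogue's letters, with (2.41)'s decay `e^{−1·1}` live): `‖E_μ({0,1}) − E_0({0,1})‖ ≤ e·1·1·(3∕2)²·(1∕12)·e⁻¹ · μ₀∕(μ₁ − μ₀)`. -/
theorem muPart_fires₂ {μ₁ μ₀ : ℝ} {μ : ℂ} (h0 : 0 < μ₀) (h01 : μ₀ < μ₁) (hμ : ‖μ‖ ≤ μ₀) :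
    ‖locE (polyInc on cubes₂) cubes₂ (act₂ μ₁ μ) univ - locE (polyInc on cubes₂) cubes₂ (act₂ μ₁ 0) univ‖ ≤
      Real.exp 1 * 1 * 1 * (3 / 2) ^ 2 * (1 / 12) * Real.exp (-(1 * 1)) * (μ₀ / (μ₁ - μ₀)) :=
  muPart_locE_le (polyInc on cubes₂) (reach := cubes₂) (d := d₂) (m := m₂) (A := 1 / 12) (R := 5) (r₁ := 1) (κ₀ := 1) (K₀ := 3 / 2) (c₁ := 1) (c := 1) (b := 1) (ν := 1)
    (dX := 1) hloc₂ (fun Z => by rw [one_mul]) hd₂ (by norm_num) (by norm_num) (by norm_num) (by norm_num) (by norm_num) (by norm_num) (by norm_num)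
    (by norm_num) h126₂ hvol₂ h227₂ (by norm_num) hsmall₂ univ_nonempty (hhol₂ μ₁) hm₂ hL3₂ h0 h01 hμ

/-- **N0j §1 `norm_locE_le_of_majorant` FIRES**: the source-uniform (2.41) envelope on the whole disc `‖s‖ < ρ`. -/
theorem norm_fires₂ {ρ : ℝ} {s : ℂ} (hs : s ∈ ball (0 : ℂ) ρ) :
    ‖locE (polyInc on cubes₂) cubes₂ (act₂ ρ s) univ‖ ≤ Real.exp 1 * 1 * 1 * (3 / 2) ^ 2 * (1 / 12) * Real.exp (-(1 * 1)) :=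
  norm_locE_le_of_majorant (polyInc on cubes₂) (reach := cubes₂) (d := d₂) (m := m₂) (A := 1 / 12) (R := 5) (r₁ := 1) (κ₀ := 1) (K₀ := 3 / 2) (c₁ := 1) (c := 1) (b := 1)
    (ν := 1) (dX := 1) hloc₂ (fun Z => by rw [one_mul]) hd₂ (by norm_num) (by norm_num) (by norm_num) (by norm_num) (by norm_num) (by norm_num) (by norm_num)
    (by norm_num) h126₂ hvol₂ h227₂ (by norm_num) hsmall₂ univ_nonempty hm₂ hL3₂ hs

/-- **N0j §1 `regenPart_locE_le` FIRES** (strength pencil of radius `ϱ = 2`): `‖E_1({0,1}) − E_0({0,1})‖ ≤ envelope∕(2 − 1)`. -/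
theorem regen_fires₂ :
    ‖locE (polyInc on cubes₂) cubes₂ (act₂ 2 1) univ - locE (polyInc on cubes₂) cubes₂ (act₂ 2 0) univ‖ ≤
      Real.exp 1 * 1 * 1 * (3 / 2) ^ 2 * (1 / 12) * Real.exp (-(1 * 1)) / (2 - 1) :=
  regenPart_locE_le (polyInc on cubes₂) (reach := cubes₂) (d := d₂) (m := m₂) (A := 1 / 12) (R := 5) (r₁ := 1) (κ₀ := 1) (K₀ := 3 / 2) (c₁ := 1) (c := 1) (b := 1) (ν := 1)
    (dX := 1) hloc₂ (fun Z => by rw [one_mul]) hd₂ (by norm_num) (by norm_num) (by norm_num) (by norm_num) (by norm_num) (by norm_num) (by norm_num)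
    (by norm_num) h126₂ hvol₂ h227₂ (by norm_num) hsmall₂ univ_nonempty (hhol₂ 2) hm₂ hL3₂ (by norm_num)

/-- **N0j §2 `differentiableOn_locE_of_majorant` FIRES**: `s ↦ E_s({0,1})` is complex differentiable on the whole disc `‖s‖ < ρ`. -/
theorem differentiableOn_fires₂ (ρ : ℝ) : DifferentiableOn ℂ (fun s => locE (polyInc on cubes₂) cubes₂ (act₂ ρ s) univ) (ball (0 : ℂ) ρ) :=
  differentiableOn_locE_of_majorant (polyInc on cubes₂) (reach := cubes₂) (d := d₂) (m := m₂) (A := 1 / 12) (R := 5) (r₁ := 1) (κ₀ := 1) (K₀ := 3 / 2) (c₁ := 1) (c := 1)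
    (b := 1) (ν := 1) hloc₂ (fun Z => by rw [one_mul]) hd₂ (by norm_num) (by norm_num) (by norm_num) (by norm_num) (by norm_num) (by norm_num) (by norm_num)
    h126₂ hvol₂ (by norm_num) hsmall₂ (hhol₂ ρ) hm₂ hL3₂

/-- **N0j §2 `muDeriv_locE_le` FIRES** (N0g's `muDeriv_norm_le_of_window` inside, both binders fed): `‖∂_s E_s({0,1})|_μ‖ ≤ 2·envelope∕(μ₁ − μ₀)`. -/
theorem muDeriv_fires₂ {μ₁ μ₀ : ℝ} {μ : ℂ} (h01 : μ₀ < μ₁) (hμ : ‖μ‖ ≤ μ₀) :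
    ‖deriv (fun s => locE (polyInc on cubes₂) cubes₂ (act₂ μ₁ s) univ) μ‖ ≤ 2 * (Real.exp 1 * 1 * 1 * (3 / 2) ^ 2 * (1 / 12) * Real.exp (-(1 * 1))) / (μ₁ - μ₀) :=
  muDeriv_locE_le (polyInc on cubes₂) (reach := cubes₂) (d := d₂) (m := m₂) (A := 1 / 12) (R := 5) (r₁ := 1) (κ₀ := 1) (K₀ := 3 / 2) (c₁ := 1) (c := 1) (b := 1) (ν := 1)
    (dX := 1) hloc₂ (fun Z => by rw [one_mul]) hd₂ (by norm_num) (by norm_num) (by norm_num) (by norm_num) (by norm_num) (by norm_num) (by norm_num)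
    (by norm_num) h126₂ hvol₂ h227₂ (by norm_num) hsmall₂ univ_nonempty (hhol₂ μ₁) hm₂ hL3₂ h01 hμ

/-- **N0j §2 `muPart_locE_le_schwarz` FIRES** (N0g's `muPart_norm_le_of_window` inside): `‖E_μ({0,1}) − E_0({0,1})‖ ≤ 2·envelope·μ₀∕μ₁`. -/
theorem schwarz_fires₂ {μ₁ μ₀ : ℝ} {μ : ℂ} (h01 : μ₀ < μ₁) (hμ : ‖μ‖ ≤ μ₀) :
    ‖locE (polyInc on cubes₂) cubes₂ (act₂ μ₁ μ) univ - locE (polyInc on cubes₂) cubes₂ (act₂ μ₁ 0) univ‖ ≤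
      2 * (Real.exp 1 * 1 * 1 * (3 / 2) ^ 2 * (1 / 12) * Real.exp (-(1 * 1))) * μ₀ / μ₁ :=
  muPart_locE_le_schwarz (polyInc on cubes₂) (reach := cubes₂) (d := d₂) (m := m₂) (A := 1 / 12) (R := 5) (r₁ := 1) (κ₀ := 1) (K₀ := 3 / 2) (c₁ := 1) (c := 1) (b := 1)
    (ν := 1) (dX := 1) hloc₂ (fun Z => by rw [one_mul]) hd₂ (by norm_num) (by norm_num) (by norm_num) (by norm_num) (by norm_num) (by norm_num) (by norm_num)
    (by norm_num) h126₂ hvol₂ h227₂ (by norm_num) hsmall₂ univ_nonempty (hhol₂ μ₁) hm₂ hL3₂ h01 hμ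

/-- THE ENVELOPE IS THE NUMBER `3∕16`: `e·1·1·(3∕2)²·(1∕12)·e⁻¹ = 3∕16` — the live decay `e^{−r₁ dX}` cancels `e`. -/
theorem envelope₂_eq : Real.exp 1 * 1 * 1 * (3 / 2 : ℝ) ^ 2 * (1 / 12) * Real.exp (-(1 * 1)) = 3 / 16 := by
  have h : Real.exp 1 * Real.exp (-(1 * 1)) = 1 := by rw [← Real.exp_add]; norm_num
  calc Real.exp 1 * 1 * 1 * (3 / 2 : ℝ) ^ 2 * (1 / 12) * Real.exp (-(1 * 1)) = Real.exp 1 * Real.exp (-(1 * 1)) * (3 / 16) := by ring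
    _ = 3 / 16 := by rw [h, one_mul]

/-- The μ-part bound in closed form: `‖E_μ({0,1}) − E_0({0,1})‖ ≤ (3∕16)·μ₀∕(μ₁ − μ₀)`. -/
theorem muPart_fires₂' {μ₁ μ₀ : ℝ} {μ : ℂ} (h0 : 0 < μ₀) (h01 : μ₀ < μ₁) (hμ : ‖μ‖ ≤ μ₀) :
    ‖locE (polyInc on cubes₂) cubes₂ (act₂ μ₁ μ) univ - locE (polyInc on cubes₂) cubes₂ (act₂ μ₁ 0) univ‖ ≤ 3 / 16 * (μ₀ / (μ₁ - μ₀)) := by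
  rw [← envelope₂_eq]; exact muPart_fires₂ h0 h01 hμ

/-- The three-polymer partition function of the two-cube catalogue (compatible families: `∅`, the singletons, `{p0, p1}`): `Z = 1 + w p01 + w p1 + w p0·(1 + w p1)`. -/
theorem Z₂_eq (w : Pol → ℂ) : polymerPartitionFunction (polyInc on cubes₂) w univ = 1 + w p01 + w p1 + w p0 * (1 + w p1) := by
  have hs : ∀ a b : Pol, (polyInc on cubes₂) a b → (polyInc on cubes₂) b a := by decide
  have h1 : ∀ γ : Pol, polymerPartitionFunction (polyInc on cubes₂) w {γ} = 1 + w γ := fun γ => by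
    rw [← insert_empty, polymerPartitionFunction_insert hs w (Finset.notMem_empty γ)]; simp
  have hu : (univ : Finset Pol) = insert p0 (insert p1 {p01}) := by decide
  have f0 : (insert p1 ({p01} : Finset Pol)).filter (fun γ' => ¬ (polyInc on cubes₂) p0 γ') = {p1} := by decide
  have f1 : ({p01} : Finset Pol).filter (fun γ' => ¬ (polyInc on cubes₂) p1 γ') = ∅ := by decide
  rw [hu, polymerPartitionFunction_insert hs w (by decide), f0, polymerPartitionFunction_insert hs w (by decide), f1, h1, h1, polymerPartitionFunction_empty,
    mul_one]

/-- B13's (2.11)–(2.12) identity `exp_sum_locE_eq_Z` FIRES on the two-cube catalogue (by name; its own sockets at `τ = 1`, `s = 0`, `b = 1` discharged):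
`exp(Σ_X E_μ(X)) = Z(act μ)` for `‖μ‖ ≤ ρ`. -/
theorem exp_sum_locE₂ {ρ : ℝ} {μ : ℂ} (hρ : 0 < ρ) (hμ : ‖μ‖ ≤ ρ) :
    Complex.exp (∑ X ∈ (univ : Finset Pol).powerset.image (fun C => C.biUnion cubes₂), locE (polyInc on cubes₂) cubes₂ (act₂ ρ μ) X) =
      polymerPartitionFunction (polyInc on cubes₂) (act₂ ρ μ) univ :=
  exp_sum_locE_eq_Z (polyInc on cubes₂) (w := act₂ ρ μ) (reach := cubes₂) (d := d₂) (A := 1 / 12) (R := 5) (κ₀ := 1) (K₀ := 3 / 2) (c₁ := 1) (τ := 1) (s := 0) (b := 1)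
    (ν := 1) hloc₂ (fun Z => by rw [one_mul]) hd₂ (by norm_num) (by norm_num) (by norm_num) le_rfl (by norm_num) (fun Z => norm_act₂_le hρ hμ Z) h126₂ hvol₂
    (by norm_num) (by simpa only [mul_one] using hsmall₂)

/-- The partition function MOVES with the source: `Z(act μ) ≠ Z(act 0) = 1` for `μ ≠ 0`, `‖μ‖ ≤ ρ` (the linear term `(μ∕ρ)·(m p0 + m p1 + m p01)` dominates
the quadratic one `(μ∕ρ)²·m p0·m p1`). -/
theorem Z₂_moves {ρ : ℝ} {μ : ℂ} (hρ : 0 < ρ) (hμ : ‖μ‖ ≤ ρ) (hne : μ ≠ 0) :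
    polymerPartitionFunction (polyInc on cubes₂) (act₂ ρ μ) univ ≠ polymerPartitionFunction (polyInc on cubes₂) (act₂ ρ 0) univ := by
  rw [Z₂_eq, Z₂_eq]
  simp only [act₂, zero_div, zero_mul, add_zero]
  set u : ℂ := μ / (ρ : ℂ) with hu
  have hu0 : u ≠ 0 := div_ne_zero hne (by exact_mod_cast hρ.ne')
  have hu1 : ‖u‖ ≤ 1 := by rw [hu, norm_div, Complex.norm_real, Real.norm_of_nonneg hρ.le]; exact (div_le_one hρ).2 hμ
  rw [show m₂ p0 = 1 / 12 by norm_num [m₂, d₂], show m₂ p1 = 1 / 12 by norm_num [m₂, d₂]]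
  push_cast; intro h
  have hS : u * ((m₂ p01 : ℂ) + 1 / 12 + 1 / 12 + u * (1 / 12 * (1 / 12))) = 0 := by linear_combination h
  rcases mul_eq_zero.1 hS with h0 | h0
  · exact hu0 h0
  · have hbig : (1 / 6 : ℝ) ≤ ‖(m₂ p01 : ℂ) + 1 / 12 + 1 / 12‖ := by
      have e : (m₂ p01 : ℂ) + 1 / 12 + 1 / 12 = ((m₂ p01 + 1 / 6 : ℝ) : ℂ) := by push_cast; ring
      rw [e, Complex.norm_real, Real.norm_of_nonneg (by linarith [m₂_nonneg p01])]; linarith [m₂_nonneg p01]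
    have hsm : ‖u * (1 / 12 * (1 / 12) : ℂ)‖ ≤ 1 / 144 := by
      rw [norm_mul]
      have e : ‖(1 / 12 * (1 / 12) : ℂ)‖ = 1 / 144 := by norm_num
      rw [e]; nlinarith [norm_nonneg u]
    have e : (m₂ p01 : ℂ) + 1 / 12 + 1 / 12 = -(u * (1 / 12 * (1 / 12))) := by linear_combination h0
    rw [e, norm_neg] at hbig
    linarith

/-- **GENUINE — THE DRESSED OUTPUT IS LIVE ON THE TWO-CUBE CATALOGUE**: for `μ ≠ 0`, `‖μ‖ ≤ ρ` (e.g. `μ = μ₀`), the table `X ↦ E_μ(X)` differs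
from `X ↦ E_0(X)` at some union `X` — the six firings above constrain a MOVING quantity. -/
theorem sum_locE₂_live {ρ : ℝ} {μ : ℂ} (hρ : 0 < ρ) (hμ : ‖μ‖ ≤ ρ) (hne : μ ≠ 0) :
    ∃ X : Finset (Fin 2), locE (polyInc on cubes₂) cubes₂ (act₂ ρ μ) X ≠ locE (polyInc on cubes₂) cubes₂ (act₂ ρ 0) X := by
  by_contra! hall
  have h1 := exp_sum_locE₂ hρ hμ
  have h0 := exp_sum_locE₂ (μ := 0) hρ (by rw [norm_zero]; exact hρ.le)
  rw [Finset.sum_congr rfl fun X _ => hall X, h0] at h1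
  exact Z₂_moves hρ hμ hne h1.symm

end TwoCubes

end Summit.QuantumFields.BalabanUV.T4Continuum.NE1p.DressedSmallFieldPencilWitness

end
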